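import Summits.BirchSwinnertonDyer.BirchSwinnertonDyer.Theorems.ByReductionTypeAtTwoTorsionEulerCharCasselsCount
import Summits.BirchSwinnertonDyer.BirchSwinnertonDyer.Theorems.ThetaPartnerAtTwoSignedControlAtTwoH1SigmaKernel
import Summits.BirchSwinnertonDyer.BirchSwinnertonDyer.Theorems.ThetaPartnerAtTwoSignedControlAtTwoCasselsLift
import Summits.BirchSwinnertonDyer.BirchSwinnertonDyer.Theorems.KolyvaginRankRigidityAtTwoStartFrameDictionary
import Literature.NumberTheory.EllipticCurves.PointDivisibilityProofs
import HarnessLib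

set_option linter.dupNamespace false -- `…BirchSwinnertonDyer.BirchSwinnertonDyer…` is the cell's nested layout (D-0017)
set_option autoImplicit false

/-!
# Greenberg LNM 1716 Lemma 4.7 WITH RATIONAL `p`-TORSION, part 11: CASSELS' COKERNEL AT ONE AUXILIARY PLACE, THE REVERSE
# COUNT — `#E(K)[p^∞] ≤ #(H¹(Γ_{K_{v₀}}, E)(p) / loc_{v₀}(U))`, hence `= #E(K)[p^∞]`, ANY PRIME `p` (`p = 2` included)

Cell `bsd-2adic` (run/shared/lean/pub/bsd-2adic/), seat `bsd-2adic-tower-1` GEN 32; `--supports stmt-BirchSwinnertonDyer-19271`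
(helper). THEOREMS ONLY (no definition, no named fact, no `sorry`); closes no item; nothing booked; BSD is not proved by any of this.

R. Greenberg, *Iwasawa theory for elliptic curves*, LNM 1716 (1999), §4 p. 104 and Appendix Prop. 4.13 (pp. 121–122): "a
theorem of Cassels which states that `𝒫_E^Σ(F)/𝒢_E^Σ(F) ≅ E(F)_p^∧`" (`= E(F)[p^∞]` when `Sel_E(F)_p` is finite), read at
one auxiliary place `v₀ ∉ S`. Part 5 (`TorsionEulerChar.finite_and_natCard_cokernel_le`, GEN 31) proved `C_{v₀}` FINITE and
`#C_{v₀} ≤ #E(K)[p^∞]`; this file proves the REVERSE inequality and hence the equality, for `E = W` elliptic over ANY number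
field `K`, ANY prime `p`, `Sel_{p^∞}(E/K)` finite, rational `p`-torsion allowed:
**`#E(K)[p^∞] ≤ #C_{v₀}`, `C_{v₀} := H¹(Γ_{K_{v₀}}, E)(p) / (loc_{v₀}(U) ∩ ·)`**, `U ≤ H¹(Γ_K, E[p^∞])` the classes unramified
outside `S ∪ {v₀}` with local class `0` on `S` and at `∞` (the receptacle of parts 3c/4/5).

Proof (no new duality: the finite-level EXACT index of part 5 §1 read in the other direction). At a deep level `p^M`
(`M ≥` the level `k₁` of `exists_natCard_map_localization_selmerGroup_eq` and the exponent level `a₀` of `E(K_{v₀})[p^∞]`,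
`exists_pow_divisible_point_adicCompletion`) consider `φ : H¹(K_{v₀}, E)[p^M] → C_{v₀}`, `a ↦ [res a]`. If `φ a = 0` then
`res a = loc_{v₀} u` with `u ∈ U`; `p^M u` is then locally trivial at `v₀` too, hence (unramified ⟹ locally trivial at the good
places off `S ∪ {v₀}`, Milne I Prop. 3.8, tree `SignedEC.H1SigmaCorank.mem_selmerGroupOver_top_of_mem_unramifiedOutside`) lies
in the FINITE group `Sel_{p^∞}(E/K̄^⊤)` of uniform exponent `p^e`; so `p^{M+e} u = 0`, `u = res_⊤ ι_* y` for some
`y ∈ H¹(K, E[p^{M+e}])` (`KolyvaginAtTwo.RegularWalk.exists_torsionPowToPrimaryH1_eq`), and `y` lies in the relaxed group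
`H¹_{𝓛, ⊤ at v₀}(K, E[p^{M+e}])` (its local Kummer conditions off `v₀` are read off `u` through the dictionary
`SignedEC.CasselsPT.localResOver_top_res_torsionPowToPrimaryH1` and the bijective local restriction). Hence
`ker φ ≤ κ_{v₀} loc_{v₀} H¹_{𝓛, ⊤ at v₀}(K, E[p^{M+e}])`, a subgroup of `H¹(K_{v₀}, E)[p^{M+e}] = H¹(K_{v₀}, E)[p^M]` (stable
level) of index `#loc_{v₀} Sel_{p^{M+e}} = #E(K)[p^∞]` (part 5 §1 `natCard_torsionBy_localH1_eq_mul`); so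
`#C_{v₀} ≥ #im φ = [H¹(K_{v₀}, E)[p^M] : ker φ] ≥ #E(K)[p^∞]`.

* §1 **`natCard_primaryComponent_le_natCard_cokernel`** — the reverse count; **`natCard_cokernel_eq`** — Cassels' theorem at
  `v₀`: `#C_{v₀} = #E(K)[p^∞]` (with part 5).

HONEST FRAMING: kernel-checked over tree theorems (GEN 31 part 5, b2b-bsdres X5/X11b, k4-p1, tp2-p3 `SignedEC`); closes no
item; no summit statement is proved; the Birch–Swinnerton-Dyer conjecture is NOT proved by any of this.

References: [GreenbergLNM1716] §4 p. 104, Prop. 4.13 (pp. 121–122); [MilneADT2006] I Prop. 3.8, Cor. 3.4, Thm. 4.10, Lemma 6.15.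
-/

noncomputable section

open scoped Classical NumberField

open NumberField IsDedekindDomain Field Function

namespace Summit.BirchSwinnertonDyer.BirchSwinnertonDyer.Theorems.TorsionEulerChar

open Literature.NumberTheory.EllipticCurves Literature.NumberTheory.GaloisRepresentations
  WeierstrassCurve Literature.NumberTheory.GaloisCohomology
  Literature.NumberTheory.EllipticCurves.GreenbergVatsal2000 Literature.NumberTheory.EllipticCurves.GreenbergSelmer

variable {K : Type} [Field K] [NumberField K] (W : WeierstrassCurve K) [W.IsElliptic] (p : ℕ) [hp : Fact p.Prime]

/-! ## §1 The reverse count at `p^∞` -/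

section Count

/-- **CASSELS' COKERNEL AT ONE AUXILIARY PLACE, THE REVERSE COUNT (Greenberg Prop. 4.13 read at `v₀`, direction `≥`).** For
`E = W` elliptic over a number field `K`, a prime `p` (`p = 2` allowed), `Sel_{p^∞}(E/K)` finite, a finite `S` off which `E`
has good reduction and `v ∤ p`, and `v₀ ∉ S`: with `P₀ = H¹(Γ_{K_{v₀}}, E)(p)` and `L = loc_{v₀}(U)`, `U ≤ H¹(Γ_K, E[p^∞])` the
classes unramified outside `S ∪ {v₀}` with local class `0` on `S` and at `∞`, **`#E(K)[p^∞] ≤ #(P₀ / (L ∩ P₀))`** (rational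
`p`-torsion allowed). See the module docstring for the proof (deep stable level `p^M`, the map `a ↦ [res a]` on
`H¹(K_{v₀}, E)[p^M]`, its kernel inside the image of the relaxed group of level `p^{M+e}`, whose index is `#E(K)[p^∞]`).
[cite: GreenbergLNM1716, §4 p. 104 and Appendix Prop. 4.13 (pp. 121–122)] [cite: MilneADT2006, Ch. I, Prop. 3.8, Thm. 4.10 and Lemma 6.15] -/
theorem natCard_primaryComponent_le_natCard_cokernel [Finite (W.selmerGroupPInfty p)]
    (S : Finset (HeightOneSpectrum (𝓞 K)))
    (hS : ∀ v ∉ S, ((p : ℕ) : 𝓞 K) ∉ v.asIdeal ∧ W.HasGoodReductionAt v)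
    (v₀ : HeightOneSpectrum (𝓞 K)) (hv₀ : v₀ ∉ S) :
    Nat.card (AddCommGroup.primaryComponent W.toAffine.Point p) ≤
      Nat.card (AddCommGroup.primaryComponent
          (discreteH1 (localSubgroup (⊤ : Subgroup (absoluteGaloisGroup K)) (v₀.adicCompletion K))
            (localPoints W (v₀.adicCompletion K))) p ⧸
        (AddSubgroup.map (W.localResOver p ⊤ (v₀.adicCompletion K))
          (unramifiedOutside (⊤ : Subgroup (absoluteGaloisGroup K)) (W.geomPrimaryTorsion p) p
              ((↑S : Set (HeightOneSpectrum (𝓞 K))) ∪ {v₀}) ⊓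
            (⨅ v ∈ S, W.localKerOver p ⊤ (v.adicCompletion K)) ⊓
            (⨅ w : InfinitePlace K, W.localKerOver p ⊤ w.Completion))).addSubgroupOf
          (AddCommGroup.primaryComponent
            (discreteH1 (localSubgroup (⊤ : Subgroup (absoluteGaloisGroup K)) (v₀.adicCompletion K))
              (localPoints W (v₀.adicCompletion K))) p)) := by
  classical
  -- notation
  let Pv := discreteH1 (localSubgroup (⊤ : Subgroup (absoluteGaloisGroup K)) (v₀.adicCompletion K))
    (localPoints W (v₀.adicCompletion K))
  let P₀ : AddSubgroup Pv := AddCommGroup.primaryComponent Pv p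
  let U : AddSubgroup (W.subgroupH1 p (⊤ : Subgroup (absoluteGaloisGroup K))) :=
    unramifiedOutside (⊤ : Subgroup (absoluteGaloisGroup K)) (W.geomPrimaryTorsion p) p
        ((↑S : Set (HeightOneSpectrum (𝓞 K))) ∪ {v₀}) ⊓
      (⨅ v ∈ S, W.localKerOver p ⊤ (v.adicCompletion K)) ⊓
      (⨅ w : InfinitePlace K, W.localKerOver p ⊤ w.Completion)
  let L : AddSubgroup Pv := U.map (W.localResOver p ⊤ (v₀.adicCompletion K))
  let C := P₀ ⧸ L.addSubgroupOf P₀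
  change _ ≤ Nat.card C
  have hprime : p.Prime := hp.out
  have hp₀ : ((p : ℕ) : 𝓞 K) ∉ v₀.asIdeal := (hS v₀ hv₀).1
  haveI hfinC : Finite C := (finite_and_natCard_cokernel_le W p S hS v₀ hv₀).1
  set B := Nat.card (AddCommGroup.primaryComponent W.toAffine.Point p) with hB
  obtain ⟨k₁, hk₁⟩ := exists_natCard_map_localization_selmerGroup_eq W p v₀ hp₀
  obtain ⟨a₀, -, ha₀⟩ := InputsGreenbergCasselsTorsion.exists_pow_divisible_point_adicCompletion W p v₀ hp₀
  -- the ambient local group `A = H¹(Γ_{K_{v₀}}, E)` and the (bijective) restriction `ρ : A → Pv`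
  let A := galoisCohomology (W.localGaloisModule (v₀.adicCompletion K)) 1
  let ρ : A →+ Pv := resH1Hom (Literature.NumberTheory.EllipticCurves.subgroupIncl
      (localSubgroup (⊤ : Subgroup (absoluteGaloisGroup K)) (v₀.adicCompletion K)))
    (AddMonoidHom.id (localPoints W (v₀.adicCompletion K))) (fun _ _ ↦ rfl)
  have hρ : Function.Bijective ρ := bijective_resH1Hom_subgroupIncl (localPoints W (v₀.adicCompletion K))
    (localSubgroup (⊤ : Subgroup (absoluteGaloisGroup K)) (v₀.adicCompletion K)) mem_localSubgroup_top
  -- the dictionary `r = res_⊤ : H¹(Γ_K, E[p^∞]) ⥲ H¹(⊤, E[p^∞])`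
  let r : W.galH1Primary p →+ W.subgroupH1 p (⊤ : Subgroup (absoluteGaloisGroup K)) :=
    resH1Hom (Literature.NumberTheory.EllipticCurves.subgroupIncl (⊤ : Subgroup (absoluteGaloisGroup K)))
      (AddMonoidHom.id (geomPrimaryTorsion W p)) (fun _ _ ↦ rfl)
  have hr : Function.Bijective r :=
    bijective_resH1Hom_subgroupIncl (geomPrimaryTorsion W p) (⊤ : Subgroup (absoluteGaloisGroup K)) Subgroup.mem_top
  -- STEP 0: a uniform exponent `p^e` for the finite group `Sel_{p^∞}(E/K̄^⊤)`
  haveI hSelfin : Finite (W.selmerGroupOver p (⊤ : Subgroup (absoluteGaloisGroup K))) :=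
    SignedEC.H1SigmaCorank.finite_selmerGroupOver_top W p
  obtain ⟨e, he⟩ : ∃ e : ℕ, ∀ y ∈ W.selmerGroupOver p (⊤ : Subgroup (absoluteGaloisGroup K)), p ^ e • y = 0 := by
    let A' : AddSubgroup (W.galH1Primary p) := (W.selmerGroupOver p (⊤ : Subgroup (absoluteGaloisGroup K))).comap r
    haveI : Finite A' := Finite.of_injective
      (fun a : A' ↦ (⟨r a, a.2⟩ : W.selmerGroupOver p (⊤ : Subgroup (absoluteGaloisGroup K))))
      (fun a b h ↦ Subtype.ext (hr.1 (congrArg Subtype.val h)))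
    obtain ⟨e, he⟩ := SignedEC.CasselsPT.exists_forall_pow_nsmul_eq_zero_of_finite W p A'
    refine ⟨e, fun y hy ↦ ?_⟩
    obtain ⟨c, rfl⟩ := hr.2 y
    rw [← map_nsmul, he c (AddSubgroup.mem_comap.mpr hy), map_zero]
  -- the levels: `M` (deep and stable), `N = M + e`
  set M := max k₁ a₀ + 1 with hMdef
  set N := M + e with hNdef
  have hM0 : 0 < M := Nat.succ_pos _
  have hMa : a₀ ≤ M := (le_max_right _ _).trans (Nat.le_succ _)
  have hMk : k₁ ≤ M := (le_max_left _ _).trans (Nat.le_succ _)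
  have hMN : M ≤ N := Nat.le_add_right _ _
  have hN0 : 0 < N := lt_of_lt_of_le hM0 hMN
  have hNk : k₁ ≤ N := hMk.trans hMN
  haveI : NeZero (p ^ M) := ⟨pow_ne_zero M hprime.ne_zero⟩
  haveI : NeZero (p ^ N) := ⟨pow_ne_zero N hprime.ne_zero⟩
  have hpM : ((p ^ M : ℕ) : 𝓞 K) ∉ v₀.asIdeal := by
    rw [Nat.cast_pow]; exact fun h ↦ hp₀ (v₀.isPrime.mem_of_pow_mem M h)
  have hpN : ((p ^ N : ℕ) : 𝓞 K) ∉ v₀.asIdeal := by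
    rw [Nat.cast_pow]; exact fun h ↦ hp₀ (v₀.isPrime.mem_of_pow_mem N h)
  -- STEP 1: the stable level — `A[p^M] = A[p^N]`
  set H := AddSubgroup.torsionBy A ((p ^ M : ℕ) : ℤ) with hH
  set HN := AddSubgroup.torsionBy A ((p ^ N : ℕ) : ℤ) with hHN
  have hkerMN : (nsmulAddMonoidHom (p ^ M) : (W.baseChange (v₀.adicCompletion K)).toAffine.Point →+ _).ker =
      (nsmulAddMonoidHom (p ^ N) : (W.baseChange (v₀.adicCompletion K)).toAffine.Point →+ _).ker := by
    ext T
    rw [AddMonoidHom.mem_ker, AddMonoidHom.mem_ker, nsmulAddMonoidHom_apply, nsmulAddMonoidHom_apply]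
    constructor
    · intro h
      rw [hNdef, pow_add, mul_comm, mul_smul, h, smul_zero]
    · intro h
      have ha := ha₀ T ⟨N, h⟩
      obtain ⟨d, hd⟩ := Nat.exists_eq_add_of_le hMa
      rw [hd, pow_add, mul_comm, mul_smul, ha, smul_zero]
  have hcardH : Nat.card H = Nat.card HN := by
    rw [hH, hHN, natCard_torsionBy_galoisCohomology_localGaloisModule_eq_of_not_mem W v₀ (p ^ M) hpM,
      natCard_torsionBy_galoisCohomology_localGaloisModule_eq_of_not_mem W v₀ (p ^ N) hpN, hkerMN]
  haveI hHNfin : Finite HN := by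
    refine Nat.finite_of_card_ne_zero ?_
    rw [hHN, natCard_torsionBy_galoisCohomology_localGaloisModule_eq_of_not_mem W v₀ (p ^ N) hpN]
    haveI := W.finite_ker_nsmul_adicCompletion v₀ (NeZero.ne (p ^ N))
    exact Nat.card_pos.ne'
  have hHle : H ≤ HN := fun a ha ↦ by
    have ha' : p ^ M • a = 0 := AddSubgroup.torsionBy.nsmul_iff.mp ha
    refine AddSubgroup.torsionBy.nsmul_iff.mpr ?_
    rw [hNdef, pow_add, mul_comm, mul_smul, ha', smul_zero]
  have hHeq : H = HN := AddSubgroup.eq_of_le_of_card_ge hHle hcardH.symm.le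
  haveI hHfin : Finite H := hHeq ▸ hHNfin
  -- STEP 2: the map `φ : H → C`, `a ↦ [ρ a]`
  have hmemP : ∀ a : H, ρ a ∈ P₀ := fun a ↦ by
    have ha : p ^ M • (a : A) = 0 := AddSubgroup.torsionBy.nsmul_iff.mp a.2
    exact (AddCommGroup.mem_primaryComponent).mpr ⟨M, by rw [← map_nsmul, ha, map_zero]⟩
  let ψ : H →+ P₀ := (ρ.comp H.subtype).codRestrict P₀ fun a ↦ hmemP a
  let φ : H →+ C := (QuotientAddGroup.mk' (L.addSubgroupOf P₀)).comp ψ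
  -- the image `G' = κ loc H¹_{𝓛, ⊤ at v₀}(K, E[p^N])` of the relaxed group of level `p^N`
  set loc := galoisCohomology.localization (W.torsionGaloisModule ((p ^ N : ℕ) : ℤ)) (Sum.inr v₀) 1 with hloc
  set κq := galoisCohomology.map (W.torsionPointsMapIntertwining ((p ^ N : ℕ) : ℤ) (v₀.adicCompletion K)) 1
    with hκq
  set G' := ((kummerOutside W (p ^ N) {Sum.inr v₀}).map loc).map κq with hG'
  have hG'H : G' ≤ H := by
    rw [hHeq]
    rintro _ ⟨y, -, rfl⟩
    refine AddSubgroup.torsionBy.nsmul_iff.mpr ?_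
    rw [← natCast_zsmul]
    exact W.zsmul_map_torsionPointsMapIntertwining (v₀.adicCompletion K) y
  -- STEP 3 (the heart): `ker φ ≤ G'`
  have hker : φ.ker ≤ G'.addSubgroupOf H := by
    intro a ha
    rw [AddMonoidHom.mem_ker] at ha
    have ha' : ψ a ∈ L.addSubgroupOf P₀ := by
      rw [← QuotientAddGroup.eq_zero_iff]
      exact ha
    rw [AddSubgroup.mem_addSubgroupOf] at ha'
    obtain ⟨u, hu, hua⟩ := ha'
    have hua' : W.localResOver p ⊤ (v₀.adicCompletion K) u = ρ (a : A) := hua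
    obtain ⟨hU12, hU3⟩ := AddSubgroup.mem_inf.mp hu
    obtain ⟨hU1, hU2⟩ := AddSubgroup.mem_inf.mp hU12
    -- `p^M u ∈ Sel_{p^∞}(E/K̄^⊤)`
    have haM : p ^ M • (a : A) = 0 := AddSubgroup.torsionBy.nsmul_iff.mp a.2
    have hsel : p ^ M • u ∈ W.selmerGroupOver p (⊤ : Subgroup (absoluteGaloisGroup K)) := by
      refine SignedEC.H1SigmaCorank.mem_selmerGroupOver_top_of_mem_unramifiedOutside W p
        (S₀ := ((↑S : Set (HeightOneSpectrum (𝓞 K))) ∪ {v₀})) (fun v hv hvp ↦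
          (hS v (fun h ↦ hv (Set.mem_union_left _ (Finset.mem_coe.mpr h)))).2)
        (p ^ M • u) (AddSubgroup.nsmul_mem _ hU1 _) (fun v hv ↦ ?_) (fun w ↦ ?_)
      · by_cases hvS : v ∈ S
        · have h0 : W.localResOver p ⊤ (v.adicCompletion K) u = 0 :=
            (W.mem_localKerOver_iff p ⊤ _ u).1 (AddSubgroup.mem_iInf.mp (AddSubgroup.mem_iInf.mp hU2 v) hvS)
          rw [map_nsmul, h0, smul_zero]
        · have hvv : v = v₀ := by
            rcases hv with hv | hv
            · rcases hv with hv | hv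
              · exact absurd (Finset.mem_coe.mp hv) hvS
              · exact Set.mem_singleton_iff.mp hv
            · exact absurd hv (hS v hvS).1
          subst hvv
          rw [map_nsmul, hua', ← map_nsmul, haM, map_zero]
      · have h0 : W.localResOver p ⊤ w.Completion u = 0 :=
          (W.mem_localKerOver_iff p ⊤ _ u).1 (AddSubgroup.mem_iInf.mp hU3 w)
        rw [map_nsmul, h0, smul_zero]
    -- hence `p^N u = 0`, and `u = res_⊤ ι_* y` with `y ∈ H¹(K, E[p^N])`
    have hNu : p ^ N • u = 0 := by
      rw [hNdef, pow_add, mul_comm, mul_smul]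
      exact he _ hsel
    obtain ⟨c, hc⟩ := hr.2 u
    have hcN : p ^ N • c = 0 := hr.1 (by rw [map_nsmul, map_zero, hc, hNu])
    obtain ⟨y, hy⟩ := KolyvaginAtTwo.RegularWalk.exists_torsionPowToPrimaryH1_eq W p N
      W.zsmul_geomPoints_surjective_holds hcN
    have huy : u = r (torsionPowToPrimaryH1 W p N y) := by rw [hy, hc]
    -- the local class of `u` vanishes at every place `≠ v₀`
    have hfin : ∀ v : HeightOneSpectrum (𝓞 K), v ≠ v₀ → W.localResOver p ⊤ (v.adicCompletion K) u = 0 := by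
      intro v hvne
      by_cases hvS : v ∈ S
      · exact (W.mem_localKerOver_iff p ⊤ _ u).1 (AddSubgroup.mem_iInf.mp (AddSubgroup.mem_iInf.mp hU2 v) hvS)
      · have hvS₀ : v ∉ ((↑S : Set (HeightOneSpectrum (𝓞 K))) ∪ {v₀}) := by
          rintro (h | h)
          · exact hvS (Finset.mem_coe.mp h)
          · exact hvne (Set.mem_singleton_iff.mp h)
        have hmem := (Literature.NumberTheory.EllipticCurves.GreenbergVatsal2000.mem_unramifiedOutside_iff u).1 hU1 v
          hvS₀ (hS v hvS).1 1
        rw [show Literature.NumberTheory.EllipticCurves.conjH1 (⊤ : Subgroup (absoluteGaloisGroup K))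
            (W.geomPrimaryTorsion p) (1 : absoluteGaloisGroup K) = AddMonoidHom.id _ from
          W.conjH1_of_mem_holds p ⊤ (Subgroup.mem_top _), AddMonoidHom.id_apply] at hmem
        exact (W.mem_localKerOver_iff p ⊤ _ u).1
          (SignedEC.H1SigmaCorank.mem_localKerOver_top_of_mem_unramifiedKer W p (hS v hvS).2 u hmem)
    have hinf : ∀ w : InfinitePlace K, W.localResOver p ⊤ w.Completion u = 0 := fun w ↦
      (W.mem_localKerOver_iff p ⊤ _ u).1 (AddSubgroup.mem_iInf.mp hU3 w)
    -- `y` lies in the relaxed group `H¹_{𝓛, ⊤ at v₀}(K, E[p^N])`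
    have hyKO : y ∈ kummerOutside W (p ^ N) {Sum.inr v₀} := by
      -- at a `K`-field `E` where the local class of `u` vanishes, `κ_E (res_E y) = 0` (bijective local restriction)
      have key : ∀ (E : Type) [Field E] [Algebra K E], W.localResOver p ⊤ E u = 0 →
          galoisCohomology.map (W.torsionPointsMapIntertwining ((p ^ N : ℕ) : ℤ) E) 1
            (galoisCohomology.res (W.torsionGaloisModule ((p ^ N : ℕ) : ℤ)) E 1 y) = 0 := by
        intro E _ _ hE
        have hbij := bijective_resH1Hom_subgroupIncl (localPoints W E)
          (localSubgroup (⊤ : Subgroup (absoluteGaloisGroup K)) E) mem_localSubgroup_top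
        refine hbij.1 ?_
        have h := SignedEC.CasselsPT.localResOver_top_res_torsionPowToPrimaryH1 W p N E y
        rw [← huy, hE] at h
        exact h.symm.trans (map_zero _).symm
      refine (mem_kummerOutside_iff W (p ^ N) {Sum.inr v₀} y).mpr ?_
      intro v hv
      rcases v with w | v
      · exact key w.Completion (hinf w)
      · have hvne : v ≠ v₀ := fun h ↦ hv (Finset.mem_singleton.mpr (by rw [h]))
        exact key (v.adicCompletion K) (hfin v hvne)
    -- conclusion of STEP 3: `a = κ_{v₀} loc_{v₀} y ∈ G'`
    rw [AddSubgroup.mem_addSubgroupOf, hG']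
    refine ⟨loc y, ⟨y, hyKO, rfl⟩, hρ.1 ?_⟩
    have h := SignedEC.CasselsPT.localResOver_top_res_torsionPowToPrimaryH1 W p N (v₀.adicCompletion K) y
    rw [← huy, hua'] at h
    exact h.symm
  -- STEP 4: the count `B = [H : G'] ≤ [H : ker φ] = #im φ ≤ #C`
  have hcardHN := natCard_torsionBy_localH1_eq_mul W p N hN0 v₀ hp₀
  have hidx : (G'.addSubgroupOf H).index = B := by
    have h1 := AddSubgroup.card_mul_index (G'.addSubgroupOf H)
    rw [Nat.card_congr (AddSubgroup.addSubgroupOfEquivOfLe hG'H).toEquiv, hcardH, hcardHN, hk₁ N hNk] at h1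
    haveI : Finite G' := Finite.of_injective _ (AddSubgroup.inclusion_injective hG'H)
    exact Nat.eq_of_mul_eq_mul_left (Nat.card_pos (α := G')) h1
  calc B = (G'.addSubgroupOf H).index := hidx.symm
    _ ≤ φ.ker.index := Nat.le_of_dvd (Nat.pos_of_ne_zero AddSubgroup.index_ne_zero_of_finite)
        (AddSubgroup.index_dvd_of_le hker)
    _ = Nat.card φ.range := AddSubgroup.index_ker φ
    _ ≤ Nat.card C := AddSubgroup.card_le_card_addGroup φ.range

/-- **CASSELS' THEOREM AT ONE AUXILIARY PLACE, WITH RATIONAL `p`-TORSION, ANY PRIME `p`: `#C_{v₀} = #E(K)[p^∞]`.** For `E = W`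
elliptic over a number field `K`, a prime `p` (`p = 2` allowed), `Sel_{p^∞}(E/K)` finite, a finite `S` off which `E` has good
reduction and `v ∤ p`, and `v₀ ∉ S`: the quotient of `H¹(Γ_{K_{v₀}}, E)(p)` by (its intersection with) `loc_{v₀}(U)` has
EXACTLY `#E(K)[p^∞]` elements — part 5 (`≤`, `finite_and_natCard_cokernel_le`) and the reverse count above (`≥`). This
discharges the displayed hypothesis `hCge` of the two-sided Greenberg Thm. 4.1 with torsion.
[cite: GreenbergLNM1716, §4 p. 104 («a theorem of Cassels») and Appendix Prop. 4.13 (pp. 121–122)] -/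
theorem natCard_cokernel_eq [Finite (W.selmerGroupPInfty p)]
    (S : Finset (HeightOneSpectrum (𝓞 K)))
    (hS : ∀ v ∉ S, ((p : ℕ) : 𝓞 K) ∉ v.asIdeal ∧ W.HasGoodReductionAt v)
    (v₀ : HeightOneSpectrum (𝓞 K)) (hv₀ : v₀ ∉ S) :
    Nat.card (AddCommGroup.primaryComponent
          (discreteH1 (localSubgroup (⊤ : Subgroup (absoluteGaloisGroup K)) (v₀.adicCompletion K))
            (localPoints W (v₀.adicCompletion K))) p ⧸
        (AddSubgroup.map (W.localResOver p ⊤ (v₀.adicCompletion K))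
          (unramifiedOutside (⊤ : Subgroup (absoluteGaloisGroup K)) (W.geomPrimaryTorsion p) p
              ((↑S : Set (HeightOneSpectrum (𝓞 K))) ∪ {v₀}) ⊓
            (⨅ v ∈ S, W.localKerOver p ⊤ (v.adicCompletion K)) ⊓
            (⨅ w : InfinitePlace K, W.localKerOver p ⊤ w.Completion))).addSubgroupOf
          (AddCommGroup.primaryComponent
            (discreteH1 (localSubgroup (⊤ : Subgroup (absoluteGaloisGroup K)) (v₀.adicCompletion K))
              (localPoints W (v₀.adicCompletion K))) p)) =
      Nat.card (AddCommGroup.primaryComponent W.toAffine.Point p) :=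
  le_antisymm (finite_and_natCard_cokernel_le W p S hS v₀ hv₀).2
    (natCard_primaryComponent_le_natCard_cokernel W p S hS v₀ hv₀)

end Count

end Summit.BirchSwinnertonDyer.BirchSwinnertonDyer.Theorems.TorsionEulerChar

end
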